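import Summits.MatrixMultiplication.MatrixMultiplication.Theorems.FarEdgeDescentFieldNode
import HarnessLib

/-!
# Route `FarEdgeDescent` — Kernel XXI-D «near-top abundance»

decomp-mm ROOT cell (D-0178), lens 2 «structural dichotomy: special vs generic», gen 45; fourth part of the
Theses-free spectral-shadow kernel (imports `FarEdgeDescentFieldNode` — hence `…SpectralHorn`, `…SpectralShadow`,
`Literature`, `Summits.….Statement` — only; every field `K`; the generic item text `ALC_K` inline).

WHAT THE GENERIC CRUX FORCES NEAR THE TOP OF THE SPECTRUM.  Write `ℓ_φ(x) = θ₁ + x·θ₂ + θ₃` for the spectral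
line of a universal point `φ`, `Σθ = ℓ_φ(1)` its value on the square, «top» for `Σθ = ω_K`.  Unconditionally
a TOP point exists (`exists_top`: the duality carrier of `⟨2,2,2⟩`) and every rational format `x = p/d` is
CARRIED by some universal point (`exists_carrier_one_rat_one`).  Under `ALC_K` and `ω_K > 2`:
* `exists_nonTop_carrier`: every rational `x > 1` is carried by a NON-top point `γ` with
  `ω_K ≤ Σθ_γ + (x−1)·θ₂(γ)` (top isolation forbids top carriers; monotonicity gives the darkness bound);
* `nearTop_abundance`: for every `g > 0` there is a non-top universal point with `ω_K − g < Σθ < ω_K` — the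
  top darkness `ω_K − 2` is a LIMIT of non-top darknesses: the spectrum ACCUMULATES at its top fibre;
* `taller_of_nonTop_carrier`: such carriers are TALLER than every top point (`θ₂(top) < θ₂(γ)`): the
  accumulation comes from the shallow side of the shadow;
* `darkValues_infinite`: the set of darkness values `Σθ ∈ (2, ω_K)` of universal points is INFINITE
  (`not_alcShape_of_finite_darkValues` is the contrapositive, a refutation handle for the leaf);
* `exists_carrier_above_parabola`: quantitatively, every rational `x > 1` is carried by a point whose line
  at `x` beats every top line `τ − (x−1)ε₀` by the parabola `(τ − ((x−1)/2)ε₀)²/τ`;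
* `not_finitelyCarried`: NO finite family of universal points carries all formats `(1,x,1)`, `x ≥ 1` —
  the pencil's support function is not finitely generated (the polytope no-go on the TRUE object).
So in the generic world with the crux the asymptotic spectrum (restricted to matrix multiplication) is not
a polytope near its top: infinitely many dark, non-optimal, ever-better certificates of the square exist —
the typed qualitative form of «the top of the shadow is blunt» (memo NODE-v45 §2(d)).

NO definitions (gate rule D-0009).  Nothing here proves `ω = 2`. -/

set_option linter.dupNamespace false

noncomputable section

open scoped BigOperators

namespace Summit.MatrixMultiplication.MatrixMultiplication.Theorems.FarEdgeDescentSpectralAbundance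

open Literature.Computability.AlgebraicComplexity
open Summit.MatrixMultiplication.MatrixMultiplication.Theorems.FarEdgeDescentSpectralShadow
open Summit.MatrixMultiplication.MatrixMultiplication.Theorems.FarEdgeDescentSpectralHorn
open Summit.MatrixMultiplication.MatrixMultiplication.Theorems.FarEdgeDescentFieldNode

variable {K : Type} [Field K]

/-- **A top point exists** (every field): some universal spectral point has `θ₁+θ₂+θ₃ = ω_K` (the
duality carrier of the square). [cite: Strassen1988, Thm. 3.8] [cite: AlmanLi2026, Proposition 4.2] -/
theorem exists_top : ∃ F : SpectralMap K, IsUniversalSpectralPoint K F ∧ ∑ i, specMMPoint K F i = omega K := by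
  obtain ⟨F, hF, hcar⟩ := exists_carrier_one_rat_one (K := K) 1 (d := 1) le_rfl
  refine ⟨F, hF, ?_⟩
  rw [sum_three, ← omegaRect_one_one_one K]
  simp only [Nat.cast_one, div_one, one_mul] at hcar
  exact hcar

/-- **Non-top carriers of every rational `x > 1`**: under `ALC_K` and `ω_K > 2`, each rational
`x = p/d > 1` is carried by a universal point `γ` which is NOT top, and `ω_K ≤ Σθ_γ + (x−1)·θ₂(γ)`.
[cite: Strassen1988, Thm. 3.8] [cite: LottiRomani1983, §2 (p. 174)] -/
theorem exists_nonTop_carrier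
    (hA : ∀ m : ℝ, 1 < m →
      (omegaRect K 1 m 1 - (m + 1)) ^ 2 ≤ (omegaRect K 1 1 1 - 2) * (omegaRect K 1 (2 * m - 1) 1 - 2 * m))
    (hω : 2 < omega K) (p : ℕ) {d : ℕ} (hd : 1 ≤ d) (hpd : d < p) :
    ∃ G : SpectralMap K, IsUniversalSpectralPoint K G ∧
      specMMPoint K G 0 + (p : ℝ) / d * specMMPoint K G 1 + specMMPoint K G 2 = omegaRect K 1 ((p : ℝ) / d) 1 ∧
      (∑ i, specMMPoint K G i) < omega K ∧
      omega K ≤ (∑ i, specMMPoint K G i) + ((p : ℝ) / d - 1) * specMMPoint K G 1 := by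
  obtain ⟨G, hG, hcar⟩ := exists_carrier_one_rat_one (K := K) p hd
  have hdpos : (0 : ℝ) < d := by exact_mod_cast (by omega : 0 < d)
  have hx : 1 < (p : ℝ) / d := by
    rw [lt_div_iff₀ hdpos, one_mul]
    exact_mod_cast hpd
  have hle : ∑ i, specMMPoint K G i ≤ omega K := AlmanLi2026.prop42_sum_le_omega hG
  have hne : ∑ i, specMMPoint K G i ≠ omega K := fun htop =>
    (top_isolated hA hω hG htop hx).ne hcar
  refine ⟨G, hG, hcar, lt_of_le_of_ne hle hne, ?_⟩
  have hmono := omegaRect_one_mid_one_mono K hx.le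
  rw [omegaRect_one_one_one, ← hcar] at hmono
  rw [sum_three]
  linarith

/-- **NEAR-TOP ABUNDANCE**: under `ALC_K` and `ω_K > 2`, for every `g > 0` some NON-top universal point has
`ω_K − g < θ₁+θ₂+θ₃ < ω_K` — the top darkness is a limit of non-top darknesses.
[cite: Strassen1988, Thm. 3.8] [cite: LottiRomani1983, Prop. 4.1] -/
theorem nearTop_abundance
    (hA : ∀ m : ℝ, 1 < m →
      (omegaRect K 1 m 1 - (m + 1)) ^ 2 ≤ (omegaRect K 1 1 1 - 2) * (omegaRect K 1 (2 * m - 1) 1 - 2 * m))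
    (hω : 2 < omega K) {g : ℝ} (hg : 0 < g) :
    ∃ G : SpectralMap K, IsUniversalSpectralPoint K G ∧
      (∑ i, specMMPoint K G i) < omega K ∧ omega K - g < ∑ i, specMMPoint K G i := by
  obtain ⟨N, hN⟩ := exists_nat_gt (1 / g)
  have hNpos : (0 : ℝ) < N := lt_trans (by positivity) hN
  have hN1 : 1 ≤ N := by exact_mod_cast hNpos
  obtain ⟨G, hG, -, hlt, hge⟩ := exists_nonTop_carrier hA hω (N + 1) hN1 (Nat.lt_succ_self N)
  refine ⟨G, hG, hlt, ?_⟩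
  have hθ := AlmanLi2026.prop42_mem_Icc hG 1
  have e : (((N + 1 : ℕ) : ℝ)) / N - 1 = 1 / N := by
    push_cast
    rw [add_div, div_self hNpos.ne', add_sub_cancel_left]
  rw [e] at hge
  have h1 : 1 / (N : ℝ) * specMMPoint K G 1 ≤ 1 / N :=
    mul_le_of_le_one_right (by positivity) hθ.2
  have h2 : 1 / (N : ℝ) < g := by
    rw [div_lt_iff₀ hNpos]
    rw [div_lt_iff₀ hg] at hN
    linarith
  linarith

/-- **Near-top carriers are TALLER than every top point**: if `γ` carries a real `x > 1` and is not top,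
then `θ₂(φ₀) < θ₂(γ)` for every top point `φ₀` (compare the two lines at `x` and at `1`).
[cite: Strassen1988, Thm. 3.8] -/
theorem taller_of_nonTop_carrier {F₀ G : SpectralMap K} (hF₀ : IsUniversalSpectralPoint K F₀)
    (htop : ∑ i, specMMPoint K F₀ i = omega K)
    (hnon : (∑ i, specMMPoint K G i) < omega K) {x : ℝ} (hx : 1 < x)
    (hcar : specMMPoint K G 0 + x * specMMPoint K G 1 + specMMPoint K G 2 = omegaRect K 1 x 1) :
    specMMPoint K F₀ 1 < specMMPoint K G 1 := by
  have h₀ := line_le_omegaRect hF₀ (by linarith : (0 : ℝ) ≤ x)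
  rw [← hcar] at h₀
  rw [sum_three] at htop hnon
  by_contra hle
  rw [not_lt] at hle
  have : (x - 1) * specMMPoint K G 1 ≤ (x - 1) * specMMPoint K F₀ 1 :=
    mul_le_mul_of_nonneg_left hle (by linarith)
  linarith

/-- **Infinitely many dark values**: under `ALC_K` and `ω_K > 2` the set of darkness values
`{θ₁+θ₂+θ₃ : universal} ∩ (2, ω_K)` is INFINITE (a finite set has a largest element `s* < ω_K`;
abundance with `g = ω_K − s*` beats it). [cite: Strassen1988, Thm. 3.8] [cite: LottiRomani1983, Prop. 4.1] -/
theorem darkValues_infinite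
    (hA : ∀ m : ℝ, 1 < m →
      (omegaRect K 1 m 1 - (m + 1)) ^ 2 ≤ (omegaRect K 1 1 1 - 2) * (omegaRect K 1 (2 * m - 1) 1 - 2 * m))
    (hω : 2 < omega K) :
    Set.Infinite {s : ℝ | (∃ F : SpectralMap K, IsUniversalSpectralPoint K F ∧ ∑ i, specMMPoint K F i = s) ∧
      2 < s ∧ s < omega K} := by
  intro hfin
  -- a bound `b < ω_K` above every element (the max if non-empty, else `2`)
  have hbound : ∃ b : ℝ, 2 ≤ b ∧ b < omega K ∧ ∀ s ∈ hfin.toFinset, s ≤ b := by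
    by_cases hne : hfin.toFinset.Nonempty
    · refine ⟨hfin.toFinset.max' hne, ?_, ?_, fun s hs => hfin.toFinset.le_max' s hs⟩
      · have hm := hfin.toFinset.max'_mem hne
        rw [Set.Finite.mem_toFinset] at hm
        exact hm.2.1.le
      · have hm := hfin.toFinset.max'_mem hne
        rw [Set.Finite.mem_toFinset] at hm
        exact hm.2.2
    · refine ⟨2, le_rfl, hω, fun s hs => ?_⟩
      exact absurd ⟨s, hs⟩ hne
  obtain ⟨b, hb2, hbω, hb⟩ := hbound
  obtain ⟨G, hG, hlt, hgt⟩ := nearTop_abundance hA hω (by linarith : 0 < omega K - b)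
  have hmem : (∑ i, specMMPoint K G i) ∈ hfin.toFinset := by
    rw [Set.Finite.mem_toFinset]
    exact ⟨⟨G, hG, rfl⟩, by linarith, hlt⟩
  have := hb _ hmem
  linarith

/-- **Carriers above the top parabola** (quantitative abundance): under `ALC_K` and `ω_K > 2`, for every top
point `φ₀` of depth `ε₀ = 1−θ₂(φ₀)` and every rational `x = p/d > 1` with `((x−1)/2)·ε₀ ≤ τ`, some universal
point `γ` carries `x` with `ℓ_γ(x) − (x+1) ≥ (τ − ((x−1)/2)ε₀)²/τ` — strictly above the top line's value
`τ − (x−1)ε₀`. [cite: Strassen1988, Thm. 3.8] [cite: LottiRomani1983, Prop. 4.1] -/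
theorem exists_carrier_above_parabola
    (hA : ∀ m : ℝ, 1 < m →
      (omegaRect K 1 m 1 - (m + 1)) ^ 2 ≤ (omegaRect K 1 1 1 - 2) * (omegaRect K 1 (2 * m - 1) 1 - 2 * m))
    (hω : 2 < omega K) {F₀ : SpectralMap K} (hF₀ : IsUniversalSpectralPoint K F₀)
    (htop : ∑ i, specMMPoint K F₀ i = omega K) (p : ℕ) {d : ℕ} (hd : 1 ≤ d) (hpd : d < p)
    (hle : ((p : ℝ) / d - 1) / 2 * (1 - specMMPoint K F₀ 1) ≤ omega K - 2) :
    ∃ G : SpectralMap K, IsUniversalSpectralPoint K G ∧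
      specMMPoint K G 0 + (p : ℝ) / d * specMMPoint K G 1 + specMMPoint K G 2 = omegaRect K 1 ((p : ℝ) / d) 1 ∧
      ((omega K - 2) - ((p : ℝ) / d - 1) / 2 * (1 - specMMPoint K F₀ 1)) ^ 2 / (omega K - 2) ≤
        specMMPoint K G 0 + (p : ℝ) / d * specMMPoint K G 1 + specMMPoint K G 2 - ((p : ℝ) / d + 1) := by
  obtain ⟨G, hG, hcar⟩ := exists_carrier_one_rat_one (K := K) p hd
  have hdpos : (0 : ℝ) < d := by exact_mod_cast (by omega : 0 < d)
  have hx : 1 < (p : ℝ) / d := by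
    rw [lt_div_iff₀ hdpos, one_mul]
    exact_mod_cast hpd
  refine ⟨G, hG, hcar, ?_⟩
  have hm : 1 < ((p : ℝ) / d + 1) / 2 := by linarith
  have h := excess_double_ge_sq hA hω hF₀ htop hm (by
    have e : ((p : ℝ) / d + 1) / 2 - 1 = ((p : ℝ) / d - 1) / 2 := by ring
    rw [e]; exact hle)
  have e1 : ((p : ℝ) / d + 1) / 2 - 1 = ((p : ℝ) / d - 1) / 2 := by ring
  have e2 : 2 * (((p : ℝ) / d + 1) / 2) - 1 = (p : ℝ) / d := by ring
  have e3 : 2 * (((p : ℝ) / d + 1) / 2) = (p : ℝ) / d + 1 := by ring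
  rw [e1, e2, e3, ← hcar] at h
  exact h

/-- **The generic leaf forbids a finitely carried pencil**: under `ALC_K` and `ω_K > 2`, NO finite family of
universal points carries every real format `(1,x,1)`, `x ≥ 1` — the support function `x ↦ ω_K(1,x,1)` is
not the maximum of finitely many spectral lines (the polytope no-go on the true object: with finitely many
generators, the top generators win on a right neighbourhood of `x = 1`, contradicting top isolation).
[cite: Strassen1988, Thm. 3.8] [cite: LottiRomani1983, Prop. 4.1] -/
theorem not_finitelyCarried
    (hA : ∀ m : ℝ, 1 < m →
      (omegaRect K 1 m 1 - (m + 1)) ^ 2 ≤ (omegaRect K 1 1 1 - 2) * (omegaRect K 1 (2 * m - 1) 1 - 2 * m))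
    (hω : 2 < omega K) (P : Finset (SpectralMap K)) (hP : ∀ F ∈ P, IsUniversalSpectralPoint K F) :
    ¬ ∀ x : ℝ, 1 ≤ x → ∃ F ∈ P,
        specMMPoint K F 0 + x * specMMPoint K F 1 + specMMPoint K F 2 = omegaRect K 1 x 1 := by
  intro hgen
  -- the non-top generators and their darkness gap `g`
  set P' := P.filter (fun F => ∑ i, specMMPoint K F i < omega K) with hP'
  -- a margin `g > 0` with `Σθ_F ≤ ω − g` for every non-top generator
  have hgap : ∃ g : ℝ, 0 < g ∧ ∀ F ∈ P', (∑ i, specMMPoint K F i) ≤ omega K - g := by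
    by_cases hne : P'.Nonempty
    · refine ⟨omega K - P'.sup' hne (fun F => ∑ i, specMMPoint K F i), ?_, fun F hF => ?_⟩
      · obtain ⟨F, hF, hmax⟩ := Finset.exists_mem_eq_sup' hne (fun F => ∑ i, specMMPoint K F i)
        rw [hmax]
        have := (Finset.mem_filter.1 hF).2
        linarith
      · have := Finset.le_sup' (fun F => ∑ i, specMMPoint K F i) hF
        linarith
    · exact ⟨1, one_pos, fun F hF => absurd ⟨F, hF⟩ hne⟩
  obtain ⟨g, hg, hgap⟩ := hgap
  -- at `x = 1 + g/2` the carrier among the generators must be top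
  set x : ℝ := 1 + g / 2 with hxdef
  have hx1 : 1 < x := by rw [hxdef]; linarith
  obtain ⟨F, hFP, hcar⟩ := hgen x hx1.le
  have hF := hP F hFP
  have hmono := omegaRect_one_mid_one_mono K hx1.le
  rw [omegaRect_one_one_one, ← hcar] at hmono
  have hθ := (AlmanLi2026.prop42_mem_Icc hF 1).2
  have htop : ∑ i, specMMPoint K F i = omega K := by
    refine le_antisymm (AlmanLi2026.prop42_sum_le_omega hF) ?_
    by_contra hlt
    rw [not_le] at hlt
    have hF' : F ∈ P' := Finset.mem_filter.2 ⟨hFP, hlt⟩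
    have h1 := hgap F hF'
    rw [sum_three] at h1
    -- `ω ≤ ℓ_F(x) = Σθ + (g/2)θ₂ ≤ ω − g + g/2 < ω`
    have h2 : (x - 1) * specMMPoint K F 1 ≤ g / 2 := by
      rw [hxdef]
      have : g / 2 * specMMPoint K F 1 ≤ g / 2 := mul_le_of_le_one_right (by linarith) hθ
      linarith
    nlinarith
  exact (top_isolated hA hω hF htop hx1).ne hcar

/-- **Refutation handle for the generic leaf** (contrapositive): over a field with `ω_K > 2`, a spectrum
with only FINITELY many darkness values in `(2, ω_K)` (e.g. a polytope spectrum) violates `ALC_K`.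
[cite: Strassen1988, Thm. 3.8] [cite: LottiRomani1983, Prop. 4.1] -/
theorem not_alcShape_of_finite_darkValues (hω : 2 < omega K)
    (hfin : Set.Finite {s : ℝ | (∃ F : SpectralMap K, IsUniversalSpectralPoint K F ∧ ∑ i, specMMPoint K F i = s) ∧
      2 < s ∧ s < omega K}) :
    ¬ ∀ m : ℝ, 1 < m →
      (omegaRect K 1 m 1 - (m + 1)) ^ 2 ≤ (omegaRect K 1 1 1 - 2) * (omegaRect K 1 (2 * m - 1) 1 - 2 * m) :=
  fun hA => darkValues_infinite hA hω hfin

end Summit.MatrixMultiplication.MatrixMultiplication.Theorems.FarEdgeDescentSpectralAbundance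

end
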